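import Summits.ValiantsHypothesis.ValiantsHypothesis.Theorems.LacunarySymmetroidMatrixDescartesCensusV19GModel
import Summits.ValiantsHypothesis.ValiantsHypothesis.Theorems.LacunarySymmetroidMatrixDescartesCensusV19SSoundRows

/-!
# `MatrixDescartes` census — soundness of the `V19G` rows (the general window row; the `V19S` rows delegated)

HONEST FRAMING.  Object-search cell `pub-symmetroid`; door-A item `DoorA26 = PosRootLawAt 2 6 19` (stmt-ValiantsHypothesis-19979; OPEN, typed,
never asserted) and its sharper support rows `PosRootLawOn 2 6 18 d`.  PROOFS, no new definitions: in a `V19G.Model` every row the checker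
`V19G.buildRow` accepts HOLDS for the position magnitudes and is well formed (`buildRow_sound`): a `base` row by door-p4 g5's
`V19S.buildRow_sound` (unchanged), a general window row `gwin W p q r` by the lone-sign argument (`two_term_of_gwinSpec`: in the four-term balance of
the model the three terms whose twisted sign differs from `q`'s carry the opposite sign, so the term of `q` equals their sum and dominates any two of
them) followed by the weighted AM–GM step of the tree (`Census.flank_amgm_row`), exactly as `V19S.rowWin_holds` (`rowGWin_holds`).  Nothing here
bears on the one-collision supports, on `ζ_sym(2,6)` over all supports, on `MatrixDescartes` (stmt-ValiantsHypothesis-18050) or on `VP ≠ VNP`.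

[folklore] Sign bookkeeping and weighted AM–GM; elementary.
-/

-- the D-0017 layout repeats a namespace component (single-conjunct summit); the `dupNamespace` linter flags it; name mandated.
set_option linter.dupNamespace false

namespace Summit.ValiantsHypothesis.ValiantsHypothesis.Theorems.LacunarySymmetroidMatrixDescartes.Census.V19G

open V20 (Atom fval Row lprod lprod_append lprod_replicate fval_nil fval_cons fval_append)
open V19S (Ctx Mode redW fval_redW redW_pos E_getD_lt)

section Rows

variable {c : Ctx} {x : ℕ → ℝ} {v : Atom → ℝ}

/-- A general window term is non-negative. [folklore] -/
theorem gterm_nonneg (M : Model c x v) (Ws : List ℕ) (t : ℕ) {y : ℝ} (hy : 0 < y) : 0 ≤ gterm c x Ws t y := by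
  unfold gterm gredWR
  exact mul_nonneg (mul_nonneg (M.base.xpos t).le (Nat.cast_nonneg _)) (pow_nonneg hy.le _)

/-- Twisted signs of positions with different `twistNeg` are opposite. [folklore] -/
theorem twistSgnR_eq_neg {Ws : List ℕ} {t q : ℕ} (h : twistNeg c Ws t ≠ twistNeg c Ws q) :
    twistSgnR c Ws t = -twistSgnR c Ws q := by
  unfold twistSgnR
  cases ht : twistNeg c Ws t <;> cases hq : twistNeg c Ws q <;> simp_all

/-- The twisted sign of `q` is `±1`, in the form `s * s = 1`. [folklore] -/
theorem twistSgnR_mul_self (Ws : List ℕ) (q : ℕ) : twistSgnR c Ws q * twistSgnR c Ws q = 1 := by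
  unfold twistSgnR; split_ifs <;> norm_num

/-- What `gwinSpec` licenses. [folklore] -/
theorem gwinSpec_cases {W : List ℕ} {p q r : ℕ} (h : gwinSpec c W p q r = true) :
    ∃ k a b e f, c.mode = .A k ∧ W = [a, b, e, f] ∧ k < 20 ∧ a < b ∧ b < e ∧ e < f ∧ f < 21 ∧ p < q ∧ q < r ∧
      (p = a ∨ p = b ∨ p = e) ∧ (q = b ∨ q = e) ∧ (r = b ∨ r = e ∨ r = f) ∧
      (∀ t, (t = a ∨ t = b ∨ t = e ∨ t = f) → t ≠ q → twistNeg c (wsums c.E W) t ≠ twistNeg c (wsums c.E W) q) := by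
  unfold gwinSpec at h
  split at h
  · next _ _ k a b e f hm =>
    rw [Bool.and_eq_true, decide_eq_true_eq] at h
    obtain ⟨⟨hk, hab, hbe, hef, hf, hpq, hqr, hp, hq, hr⟩, hall⟩ := h
    refine ⟨k, a, b, e, f, hm, rfl, hk, hab, hbe, hef, hf, hpq, hqr, hp, hq, hr, ?_⟩
    intro t ht htq
    have hmem : t ∈ [a, b, e, f] := by simp only [List.mem_cons, List.not_mem_nil, or_false]; exact ht
    have := List.all_eq_true.1 hall t hmem
    rw [Bool.or_eq_true] at this
    rcases this with h1 | h1
    · exact absurd (by simpa using h1) htq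
    · simpa using h1
  · exact absurd h (by simp)

/-- In a `V19G` model, a licensed general window row admits the two-term bound `T_p(y) + T_r(y) ≤ T_q(y)` at some `y > 0` (general window terms of
the window's sums): the lone term equals the sum of the other three. [folklore] -/
theorem two_term_of_gwinSpec (M : Model c x v) {W : List ℕ} {p q r : ℕ} (h : gwinSpec c W p q r = true) :
    ∃ y : ℝ, 0 < y ∧ gterm c x (wsums c.E W) p y + gterm c x (wsums c.E W) r y ≤ gterm c x (wsums c.E W) q y := by
  obtain ⟨k, a, b, e, f, hm, hW, -, hab, hbe, hef, hf, hpq, hqr, hp, hq, hr, hl⟩ := gwinSpec_cases h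
  subst hW
  obtain ⟨y, hy, hbal⟩ := M.gbal k a b e f hm hab hbe hef hf
  refine ⟨y, hy, ?_⟩
  set Ws := wsums c.E [a, b, e, f] with hWs
  have h0a := gterm_nonneg M Ws a hy
  have h0b := gterm_nonneg M Ws b hy
  have h0e := gterm_nonneg M Ws e hy
  have h0f := gterm_nonneg M Ws f hy
  have hsq := twistSgnR_mul_self (c := c) Ws q
  rcases hq with rfl | rfl
  · -- lone term at `b = q`: `p = a`, `r ∈ {e, f}`
    have ha' := twistSgnR_eq_neg (hl a (Or.inl rfl) (by omega))
    have he' := twistSgnR_eq_neg (hl e (Or.inr (Or.inr (Or.inl rfl))) (by omega))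
    have hf' := twistSgnR_eq_neg (hl f (Or.inr (Or.inr (Or.inr rfl))) (by omega))
    rw [ha', he', hf'] at hbal
    have key : gterm c x Ws q y = gterm c x Ws a y + gterm c x Ws e y + gterm c x Ws f y := by
      have : twistSgnR c Ws q * (gterm c x Ws q y - gterm c x Ws a y - gterm c x Ws e y - gterm c x Ws f y) = 0 := by linarith
      have := congrArg (fun z => twistSgnR c Ws q * z) this
      simp only [← mul_assoc, hsq, one_mul, mul_zero] at this
      linarith
    have hpa : p = a := by omega
    subst hpa
    rcases hr with rfl | rfl | rfl
    · omega
    · linarith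
    · linarith
  · -- lone term at `e = q`: `p ∈ {a, b}`, `r = f`
    have ha' := twistSgnR_eq_neg (hl a (Or.inl rfl) (by omega))
    have hb' := twistSgnR_eq_neg (hl b (Or.inr (Or.inl rfl)) (by omega))
    have hf' := twistSgnR_eq_neg (hl f (Or.inr (Or.inr (Or.inr rfl))) (by omega))
    rw [ha', hb', hf'] at hbal
    have key : gterm c x Ws q y = gterm c x Ws a y + gterm c x Ws b y + gterm c x Ws f y := by
      have : twistSgnR c Ws q * (gterm c x Ws q y - gterm c x Ws a y - gterm c x Ws b y - gterm c x Ws f y) = 0 := by linarith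
      have := congrArg (fun z => twistSgnR c Ws q * z) this
      simp only [← mul_assoc, hsq, one_mul, mul_zero] at this
      linarith
    have hrf : r = f := by omega
    subst hrf
    rcases hp with rfl | rfl | rfl
    · linarith
    · linarith
    · omega

/-- The general window row built for a licensed `(W, p, q, r)` holds in the model. [folklore] -/
theorem rowGWin_holds (M : Model c x v) {W : List ℕ} {p q r : ℕ} (h : gwinSpec c W p q r = true) :
    (rowGWin c.E (wsums c.E W) p q r).Holds x := by
  obtain ⟨k, a, b, e, f, -, -, -, hab, hbe, hef, hf, hpq, hqr, hp, -, hr, -⟩ := gwinSpec_cases h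
  have hr21 : r < 21 := by omega
  obtain ⟨y, hy, hle⟩ := two_term_of_gwinSpec M h
  have epq := E_getD_lt M.base hpq (hqr.trans hr21)
  have eqr := E_getD_lt M.base hqr hr21
  generalize hWs : wsums c.E W = Ws at hle ⊢
  unfold gterm gredWR at hle
  unfold Row.Holds rowGWin
  dsimp only
  generalize hep : c.E.getD p 0 = ep at epq hle ⊢
  generalize heq : c.E.getD q 0 = eq at epq eqr hle ⊢
  generalize her : c.E.getD r 0 = er at eqr hle ⊢
  have hPp0 : (0 : ℝ) ≤ (fval (redW c.E Ws ep 1) : ℝ) := Nat.cast_nonneg _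
  have hPr0 : (0 : ℝ) ≤ (fval (redW c.E Ws er 1) : ℝ) := Nat.cast_nonneg _
  have hle' : x p * (fval (redW c.E Ws ep 1) : ℝ) * y ^ ep + x r * (fval (redW c.E Ws er 1) : ℝ) * y ^ er
      ≤ ((1 : ℕ) : ℝ) * x q * (fval (redW c.E Ws eq 1) : ℝ) * y ^ eq := by
    have e1 : ((1 : ℕ) : ℝ) * x q * (fval (redW c.E Ws eq 1) : ℝ) * y ^ eq = x q * (fval (redW c.E Ws eq 1) : ℝ) * y ^ eq := by
      push_cast; ring
    rw [e1]; exact hle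
  have key := flank_amgm_row (p := ep) (q := eq) (r := er) (α := eq - ep) (β := er - eq) (n := eq - ep + (er - eq))
    (by omega) (by omega) rfl (by omega) (by omega) rfl rfl (mul_nonneg (M.base.xpos p).le hPp0) (mul_nonneg (M.base.xpos r).le hPr0) hy hle'
  rw [lprod_append, lprod_replicate, lprod_replicate, lprod_replicate]
  simp only [fval_append, fval_cons, fval_nil]
  push_cast
  rw [fval_redW c.E _ ep (er - eq), fval_redW c.E _ er (eq - ep), fval_redW c.E _ eq (eq - ep + (er - eq))]
  calc _ = (((eq - ep : ℕ) : ℝ) + ((er - eq : ℕ) : ℝ)) ^ (eq - ep + (er - eq))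
        * (x p * (fval (redW c.E Ws ep 1) : ℝ)) ^ (er - eq)
        * (x r * (fval (redW c.E Ws er 1) : ℝ)) ^ (eq - ep) := by ring
    _ ≤ ((eq - ep : ℕ) : ℝ) ^ (eq - ep) * ((er - eq : ℕ) : ℝ) ^ (er - eq)
        * (((1 : ℕ) : ℝ) * x q * (fval (redW c.E Ws eq 1) : ℝ)) ^ (eq - ep + (er - eq)) := key
    _ = _ := by push_cast; ring

/-! ### All rows -/

/-- Every row the `V19G` checker builds holds in the model and is well formed. [folklore] -/
theorem buildRow_sound (M : Model c x v) {rs : GRow} {r : Row} (h : buildRow c rs = some r) : r.Holds x ∧ r.WF := by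
  cases rs with
  | base rs' => exact V19S.buildRow_sound M.base h
  | gwin W p q r' =>
    simp only [buildRow] at h
    split_ifs at h with hs
    cases h
    obtain ⟨k, a, b, e, f, -, -, -, hab, hbe, hef, hf, hpq, hqr, hp, -, hr, -⟩ := gwinSpec_cases hs
    have hr21 : r' < 21 := by omega
    have epq := E_getD_lt M.base hpq (hqr.trans hr21)
    have eqr := E_getD_lt M.base hqr hr21
    refine ⟨rowGWin_holds M hs, ?_, ?_, ?_, ?_⟩
    · intro u hu
      simp only [rowGWin, List.mem_append, List.mem_replicate] at hu
      omega
    · intro u hu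
      simp only [rowGWin, List.mem_replicate] at hu
      omega
    · intro be hbe
      simp only [rowGWin, List.mem_append, List.mem_cons, List.not_mem_nil, or_false] at hbe
      rcases hbe with hbe | rfl | rfl | rfl
      · exact redW_pos _ _ _ _ be hbe
      · exact one_pos
      · show 0 < c.E.getD q 0 - c.E.getD p 0
        omega
      · show 0 < c.E.getD r' 0 - c.E.getD q 0
        omega
    · intro be hbe
      simp only [rowGWin, List.mem_append, List.mem_singleton] at hbe
      rcases hbe with (hbe | hbe) | rfl
      · exact redW_pos _ _ _ _ be hbe
      · exact redW_pos _ _ _ _ be hbe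
      · show 0 < c.E.getD q 0 - c.E.getD p 0 + (c.E.getD r' 0 - c.E.getD q 0)
        omega

end Rows

end Summit.ValiantsHypothesis.ValiantsHypothesis.Theorems.LacunarySymmetroidMatrixDescartes.Census.V19G
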